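import Literature.NumberTheory.LFunctions.JensenXiLadderBox
import HarnessLib

/-!
# Ladder boxes: monotonicity in `(c, m, δ)` and the `θ`-deflated Gaussian table

Two small additions to `JensenXiLadderBox.lean` that decouple the ANALYTIC side (which proves
`LadderMomentBounds d c' M δ' n` with whatever table `c'`, variance level `M` and `δ'` its estimates
give) from the KERNEL side (which certifies ONE box `B_d(m, δ)` with a fixed table `c`, as large as the
sign certificate allows):

* `ladderMomentBounds_mono` — `LadderMomentBounds` is monotone: `c' ≤ c` (entrywise on `3 ≤ l ≤ 2d`,
  `c' ≥ 0`), `M ≤ m`, `δ' ≤ δ` turn `LadderMomentBounds d c' M δ' n` into `LadderMomentBounds d c m δ n`;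
* `thetaGaussLadderConst θ l = gaussLadderConst l / θ^{l-1}` — the Gaussian table deflated by a bulk-mass
  parameter `θ ∈ (0, 1]`, the shape `g_l · m^{l/2} / θ^{l-1}` in which the Brascamp–Lieb /
  Gaussian-domination tail lemma delivers its odd and even faces after un-conditioning from the bulk
  [BrascampLieb1976, Thm. 5.1]; `thetaGaussLadderConst_nonneg`, and the comparison
  `gaussLadderConst_le_thetaGauss` (`θ ≤ 1`).

## References
* [BrascampLieb1976] H. J. Brascamp, E. H. Lieb, J. Funct. Anal. 22 (1976) 366–389, Thms. 4.1, 5.1.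
* [GORZPNAS2019] Griffin–Ono–Rolen–Zagier, PNAS 116 (2019), Thm. 7, §5.1.
-/

open Polynomial Finset

namespace Literature.NumberTheory.LFunctions

/-- **Monotonicity of the ladder box hypothesis:** a smaller table, a smaller variance level and a
smaller `δ` give a stronger statement. [cite: BrascampLieb1976, Thm. 5.1] -/
theorem ladderMomentBounds_mono {d n : ℕ} {c c' : ℕ → ℚ} {m M δ δ' : ℚ}
    (h : LadderMomentBounds d c' M δ' n) (hc0 : ∀ l, 0 ≤ c' l)
    (hc : ∀ l, 3 ≤ l → l ≤ 2 * d → c' l ≤ c l) (hM : M ≤ m) (hδ : δ' ≤ δ) :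
    LadderMomentBounds d c m δ n := by
  obtain ⟨h1, h2, h3, hl⟩ := h
  have hM0 : (0 : ℝ) ≤ M := h2.trans h3
  have hMm : (M : ℝ) ≤ m := by exact_mod_cast hM
  have hpow : ∀ k : ℕ, (M : ℝ) ^ k ≤ (m : ℝ) ^ k := fun k => pow_le_pow_left₀ hM0 hMm k
  have hsqrt : Real.sqrt M ≤ Real.sqrt m := Real.sqrt_le_sqrt hMm
  refine ⟨h1.trans (by exact_mod_cast hδ), h2, h3.trans hMm, fun l hl3 hl2 => ?_⟩
  obtain ⟨he, ho⟩ := hl l hl3 hl2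
  have hcl : (c' l : ℝ) ≤ c l := by exact_mod_cast hc l hl3 hl2
  have hc0l : (0 : ℝ) ≤ c' l := by exact_mod_cast hc0 l
  have hK : (21 / 20 : ℝ) * (c' l : ℝ) * (M : ℝ) ^ (l / 2) ≤ (21 / 20 : ℝ) * (c l : ℝ) * (m : ℝ) ^ (l / 2) :=
    mul_le_mul (mul_le_mul_of_nonneg_left hcl (by norm_num)) (hpow _) (pow_nonneg hM0 _)
      (mul_nonneg (by norm_num) (hc0l.trans hcl))
  refine ⟨fun hev => ?_, fun hod => ?_⟩
  · obtain ⟨ha, hb⟩ := he hev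
    exact ⟨ha, hb.trans hK⟩
  · refine (ho hod).trans ?_
    exact mul_le_mul hK hsqrt (Real.sqrt_nonneg _)
      (mul_nonneg (mul_nonneg (by norm_num) (hc0l.trans hcl)) (pow_nonneg (h2.trans (h3.trans hMm)) _))

/-- The `θ`-deflated Gaussian table `g_l / θ^{l-1}` (`θ` = a lower bound for the bulk mass in the
un-conditioning step; `θ = 1` is the Gaussian table itself). [cite: BrascampLieb1976, Thm. 5.1] -/
def thetaGaussLadderConst (θ : ℚ) (l : ℕ) : ℚ := gaussLadderConst l / θ ^ (l - 1)

/-- The deflated table is `≥ 0` for `θ ≥ 0`. [cite: BrascampLieb1976, Thm. 5.1] -/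
theorem thetaGaussLadderConst_nonneg {θ : ℚ} (hθ : 0 ≤ θ) (l : ℕ) :
    0 ≤ thetaGaussLadderConst θ l :=
  div_nonneg (gaussLadderConst_nonneg l) (pow_nonneg hθ _)

/-- For `0 < θ ≤ 1` the deflated table dominates the Gaussian one. [cite: BrascampLieb1976, Thm. 5.1] -/
theorem gaussLadderConst_le_thetaGauss {θ : ℚ} (hθ0 : 0 < θ) (hθ1 : θ ≤ 1) (l : ℕ) :
    gaussLadderConst l ≤ thetaGaussLadderConst θ l := by
  unfold thetaGaussLadderConst
  rw [le_div_iff₀ (pow_pos hθ0 _)]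
  exact mul_le_of_le_one_right (gaussLadderConst_nonneg l) (pow_le_one₀ hθ0.le hθ1)

/-- A smaller `θ` deflates more: the table is antitone in `θ ∈ (0, 1]`. [cite: BrascampLieb1976, Thm. 5.1] -/
theorem thetaGaussLadderConst_mono {θ θ' : ℚ} (hθ0 : 0 < θ) (hθθ : θ ≤ θ') (l : ℕ) :
    thetaGaussLadderConst θ' l ≤ thetaGaussLadderConst θ l := by
  unfold thetaGaussLadderConst
  exact div_le_div_of_nonneg_left (gaussLadderConst_nonneg l) (pow_pos hθ0 _)
    (pow_le_pow_left₀ hθ0.le hθθ _)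

/-! ## The odd-inflated Gaussian table (appended for the cell-free rows of record, jensen-lead J-R18/J-R19) -/

/-- The Gaussian table with its ODD entries inflated by a factor `κ`: `c_{2j} = (2j-1)!!`,
`c_{2i+1} = κ·g_{2i+1}` — the face shape in which the track's Theorem A rows are proved (even faces by
Gaussian domination exactly, odd absolute moments up to a rounding factor `κ ≤ 1.1`).
[cite: BrascampLieb1976, Thm. 5.1] -/
def kappaGaussLadderConst (κ : ℚ) (l : ℕ) : ℚ :=
  if l % 2 = 0 then gaussLadderConst l else κ * gaussLadderConst l

/-- The inflated table is `≥ 0` for `κ ≥ 0`. [cite: BrascampLieb1976, Thm. 5.1] -/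
theorem kappaGaussLadderConst_nonneg {κ : ℚ} (hκ : 0 ≤ κ) (l : ℕ) :
    0 ≤ kappaGaussLadderConst κ l := by
  unfold kappaGaussLadderConst
  split_ifs
  · exact gaussLadderConst_nonneg l
  · exact mul_nonneg hκ (gaussLadderConst_nonneg l)

/-- The inflated table is monotone in `κ` (entrywise). [cite: BrascampLieb1976, Thm. 5.1] -/
theorem kappaGaussLadderConst_mono {κ κ' : ℚ} (h : κ ≤ κ') (l : ℕ) :
    kappaGaussLadderConst κ l ≤ kappaGaussLadderConst κ' l := by
  unfold kappaGaussLadderConst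
  split_ifs
  · exact le_rfl
  · exact mul_le_mul_of_nonneg_right h (gaussLadderConst_nonneg l)

/-- For `κ ≥ 1` the inflated table dominates the Gaussian one. [cite: BrascampLieb1976, Thm. 5.1] -/
theorem gaussLadderConst_le_kappaGauss {κ : ℚ} (hκ : 1 ≤ κ) (l : ℕ) :
    gaussLadderConst l ≤ kappaGaussLadderConst κ l := by
  unfold kappaGaussLadderConst
  split_ifs
  · exact le_rfl
  · exact le_mul_of_one_le_left (gaussLadderConst_nonneg l) hκ

end Literature.NumberTheory.LFunctions
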